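import Literature.AnabelianGeometry.EtaleTheta.CyclotomeAutZHat
import Literature.AnabelianGeometry.EtaleTheta.Discharge.Sec2GaloisDictionaryOfSetting
import HarnessLib

/-!
# The cyclotomic character `χ : G_{ℚ_p} → Ẑ^×` of the fixed algebraic closure `ℚ̄_p`, its level-`N`
# shadows `χ_N : G_{ℚ_p} → ℤ/Nℤ`, locally constant in the Krull topology
# (R78 cluster of the abc-iut cell, file F3 (a2) of abc-iut-L2-lead ROWS #13 R100)

S. Mochizuki, *The étale theta function and its Frobenioid-theoretic manifestations*, Publ. RIMS **45**
(2009) [EtTh], §1 p. 13 ("`K_N := K(ζ_N, q_X^{1/N})` — where `ζ_N` is a primitive `N`-th root of unity";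
the Galois group `G_K` acts on `μ_N` through the cyclotomic character) [cite: MochizukiEtTh2009, §1 p.13];
J. Neukirch, *Algebraic Number Theory*, Ch. IV §1 (Krull topology: stabilisers of algebraic elements are
open) [cite: NeukirchANT1999, Ch. IV §1].

abc-iut cell, layer L2, seat abc-iut-w5-d091 (gen 4): CLASSICAL INPUT of the «χ-twisted root model»
(R78, integration owner abc-iut-L6-d6; consumers F2 `SettingModelChiTwist` / F4 `SettingModelChiSemidirect` /
F5 `SettingModelChiTheta`).  CONSTRUCTION + proofs over landed decls only (abc-iut-w4-d056's
`cyclotome.existsUnique_zhatTwist_eq_map_of_isSepClosed`, abc-iut-w4-d024's `cyclotome.zhatTwist` /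
`ZHatLevel.levelChar`, abc-iut-L2-t11's `isLocallyConstant_smul_units_of_isAlgebraic`); no instance, no
notation, no Prop-valued definition, nothing of [EtTh] asserted:

* `galUnits p σ : ℚ̄_pˣ ≃* ℚ̄_pˣ` — `σ ∈ G_{ℚ_p} = GQp p` acting on the units of `ℚ̄_p = PadicAlgCl p`;
* **`chi p : GQp p →* MulAut Ẑ`** (`MulAut (completion (GrpCat.of (Multiplicative ℤ)))` = the tree's
  `ZHatUnits`; `Aut(Ẑ) = Ẑ^×`, `CyclotomeAutZHat`) — THE cyclotomic character: the UNIQUE `u` with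
  `Λ(σ) = zhatTwist u` on the cyclotome `Λ(ℚ̄_pˣ) = lim_n μ_n(ℚ̄_p)` (`chi_spec`, `chi_unique`); canonical (no
  choice of `Λ(ℚ̄_pˣ) ≅ Ẑ` enters);
* `apply_eq_pow_levelChar_chi` — **`σ(μ) = μ ^ χ_N(σ)` for every `N`-th root of unity `μ ∈ ℚ̄_p`**, where
  `χ_N(σ) := ZHatLevel.levelChar N (chi p σ) ∈ ℤ/Nℤ` is the mod-`N` cyclotomic character, and
  `levelChar_chi_eq_of_isPrimitiveRoot` — `χ_N(σ)` is determined by the action on ONE primitive root;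
* **`isLocallyConstant_levelChar_chi`** — `σ ↦ χ_N(σ)` is LOCALLY CONSTANT on `G_{ℚ_p}` (Krull topology):
  the input of the joint continuity of the twisted semidirect products of F4 (`isOpen_setOf_levelChar_chi_eq`).
The Krull-openness of `G_{K_N}`, `G_{J_N}` (clauses `isOpen_GtpYN` / `isOpen_GtpZN` of the χ-model) is NOT here:
it is abc-iut-L2-t1's `finiteDimensional_fieldKN` / abc-iut-L2-t11's `SettingModelKrullOpenSubgroups`
(`isOpen_fixingSubgroup_fieldKN` / `_fieldJN`), consumed BY NAME.

A model is consistency evidence only; nothing here bears on [IUTchIII] Cor. 3.12.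
-/

noncomputable section

open CategoryTheory ProfiniteGrp ProfiniteGrp.ProfiniteCompletion

namespace Literature.AnabelianGeometry.EtaleTheta.SettingModel

open Literature.AnabelianGeometry.SemiGraphs (GQp)

variable (p : ℕ) [Fact p.Prime]

/-! ### `G_{ℚ_p}` acting on `ℚ̄_pˣ` -/

/-- `ℚ̄_p` has characteristic `0`. [cite: NeukirchANT1999, Ch. II §5] -/
theorem charZero_padicAlgCl : CharZero (PadicAlgCl p) :=
  charZero_of_injective_algebraMap (algebraMap ℚ_[p] (PadicAlgCl p)).injective

/-- `σ ∈ G_{ℚ_p}` as an automorphism of the multiplicative group `ℚ̄_pˣ`. [cite: MochizukiEtTh2009, §1 p.13] -/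
def galUnits (σ : GQp p) : (PadicAlgCl p)ˣ ≃* (PadicAlgCl p)ˣ :=
  Units.mapEquiv (σ : PadicAlgCl p ≃ₐ[ℚ_[p]] PadicAlgCl p).toMulEquiv

/-- `galUnits p σ x = σ x` on underlying elements. [cite: MochizukiEtTh2009, §1 p.13] -/
@[simp] theorem coe_galUnits_apply (σ : GQp p) (x : (PadicAlgCl p)ˣ) :
    ((galUnits p σ x : (PadicAlgCl p)ˣ) : PadicAlgCl p) = σ (x : PadicAlgCl p) := rfl

/-- `galUnits p σ x` is the Galois action `σ • x` on units (Mathlib's `MulDistribMulAction` of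
`Aut_{ℚ_p}(ℚ̄_p)` on `ℚ̄_pˣ`). [cite: MochizukiEtTh2009, §1 p.13] -/
theorem galUnits_apply_eq_smul (σ : GQp p) (x : (PadicAlgCl p)ˣ) : galUnits p σ x = σ • x := by
  apply Units.ext
  rw [coe_galUnits_apply, AlgEquiv.smul_units_def, Units.coe_map, MonoidHom.coe_coe]

/-- `galUnits p 1 = id`. [cite: MochizukiEtTh2009, §1 p.13] -/
theorem galUnits_one : galUnits p 1 = MulEquiv.refl _ := by
  ext x; rfl

/-- `galUnits p (σ τ) = galUnits p σ ∘ galUnits p τ`. [cite: MochizukiEtTh2009, §1 p.13] -/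
theorem galUnits_mul (σ τ : GQp p) : galUnits p (σ * τ) = (galUnits p τ).trans (galUnits p σ) := by
  ext x; rfl

/-! ### The cyclotomic character `χ : G_{ℚ_p} → Aut(Ẑ) = Ẑ^×` -/

/-- For every `σ ∈ G_{ℚ_p}` there is a UNIQUE `u ∈ Aut(Ẑ)` with `Λ(σ) = zhatTwist u` on `Λ(ℚ̄_pˣ)`
(abc-iut-w4-d056's `cyclotome.existsUnique_zhatTwist_eq_map_of_isSepClosed` at `ℚ̄_p`).
[cite: MochizukiEtTh2009, §1 p.13] -/
theorem existsUnique_zhatTwist_eq_map_galUnits (σ : GQp p) :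
    ∃! u : MulAut (completion (GrpCat.of (Multiplicative ℤ))),
      ∀ ζ : cyclotome (PadicAlgCl p)ˣ,
        cyclotome.map (galUnits p σ).toMonoidHom ζ = cyclotome.zhatTwist (PadicAlgCl p)ˣ u ζ := by
  haveI := charZero_padicAlgCl p
  exact cyclotome.existsUnique_zhatTwist_eq_map_of_isSepClosed (PadicAlgCl p) (galUnits p σ)

/-- The function underlying `chi`. [cite: MochizukiEtTh2009, §1 p.13] -/
def chiFun (σ : GQp p) : MulAut (completion (GrpCat.of (Multiplicative ℤ))) :=
  Classical.choose (existsUnique_zhatTwist_eq_map_galUnits p σ).exists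

/-- Defining property of `chiFun`: `Λ(σ) = zhatTwist (chiFun σ)`. [cite: MochizukiEtTh2009, §1 p.13] -/
theorem chiFun_spec (σ : GQp p) (ζ : cyclotome (PadicAlgCl p)ˣ) :
    cyclotome.map (galUnits p σ).toMonoidHom ζ = cyclotome.zhatTwist (PadicAlgCl p)ˣ (chiFun p σ) ζ :=
  Classical.choose_spec (existsUnique_zhatTwist_eq_map_galUnits p σ).exists ζ

/-- Uniqueness: any `u` with `Λ(σ) = zhatTwist u` is `chiFun σ`. [cite: MochizukiEtTh2009, §1 p.13] -/
theorem eq_chiFun_of_forall {σ : GQp p} {u : MulAut (completion (GrpCat.of (Multiplicative ℤ)))}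
    (h : ∀ ζ : cyclotome (PadicAlgCl p)ˣ,
      cyclotome.map (galUnits p σ).toMonoidHom ζ = cyclotome.zhatTwist (PadicAlgCl p)ˣ u ζ) :
    u = chiFun p σ :=
  (existsUnique_zhatTwist_eq_map_galUnits p σ).unique h (chiFun_spec p σ)

/-- **The cyclotomic character `χ : G_{ℚ_p} → Aut(Ẑ) = Ẑ^×`** of the fixed algebraic closure `ℚ̄_p`: the
homomorphism `σ ↦` (the unique `u` with `Λ(σ) = zhatTwist u` on `Λ(ℚ̄_pˣ) = lim_n μ_n(ℚ̄_p)`); so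
`σ(ζ_n) = ζ_n ^ χ_n(σ)` for every compatible system of roots of unity.  Multiplicativity by uniqueness
(`Λ(σ τ) = Λ(σ) ∘ Λ(τ)`, `zhatTwist` a homomorphism). [cite: MochizukiEtTh2009, §1 p.13] -/
def chi : GQp p →* MulAut (completion (GrpCat.of (Multiplicative ℤ))) where
  toFun := chiFun p
  map_one' := (eq_chiFun_of_forall p (σ := 1) (u := 1) fun ζ => by
    rw [map_one, galUnits_one]
    exact Subtype.ext (funext fun n => rfl)).symm
  map_mul' σ τ := (eq_chiFun_of_forall p (σ := σ * τ) (u := chiFun p σ * chiFun p τ) fun ζ => by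
    rw [map_mul, MulAut.mul_apply, ← chiFun_spec p σ, ← chiFun_spec p τ, galUnits_mul]
    exact Subtype.ext (funext fun n => rfl)).symm

/-- `chi p σ = chiFun p σ`. [cite: MochizukiEtTh2009, §1 p.13] -/
theorem chi_apply (σ : GQp p) : chi p σ = chiFun p σ := rfl

/-- **Defining property of `χ`**: `Λ(σ) = zhatTwist (χ σ)` on the cyclotome of `ℚ̄_pˣ`.
[cite: MochizukiEtTh2009, §1 p.13] -/
theorem chi_spec (σ : GQp p) (ζ : cyclotome (PadicAlgCl p)ˣ) :
    cyclotome.map (galUnits p σ).toMonoidHom ζ = cyclotome.zhatTwist (PadicAlgCl p)ˣ (chi p σ) ζ :=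
  chiFun_spec p σ ζ

/-- **Uniqueness of `χ(σ)`**. [cite: MochizukiEtTh2009, §1 p.13] -/
theorem chi_unique {σ : GQp p} {u : MulAut (completion (GrpCat.of (Multiplicative ℤ)))}
    (h : ∀ ζ : cyclotome (PadicAlgCl p)ˣ,
      cyclotome.map (galUnits p σ).toMonoidHom ζ = cyclotome.zhatTwist (PadicAlgCl p)ˣ u ζ) :
    u = chi p σ :=
  eq_chiFun_of_forall p h

/-- Componentwise: `σ(ζ_n) = ζ_n ^ χ_n(σ)` for every compatible system `ζ ∈ Λ(ℚ̄_pˣ)` and every `n`, with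
`χ_n(σ) := levelChar n (χ σ)`. [cite: MochizukiEtTh2009, §1 p.13] -/
theorem apply_cyclotome_eq_pow (σ : GQp p) (ζ : cyclotome (PadicAlgCl p)ˣ) (n : ℕ+) :
    σ (((ζ : ℕ+ → (PadicAlgCl p)ˣ) n : (PadicAlgCl p)ˣ) : PadicAlgCl p) =
      (((ζ : ℕ+ → (PadicAlgCl p)ˣ) n : (PadicAlgCl p)ˣ) : PadicAlgCl p) ^
        (ZHatLevel.levelChar n (chi p σ)).val := by
  have h := congrArg (fun ξ : cyclotome (PadicAlgCl p)ˣ => (((ξ : ℕ+ → (PadicAlgCl p)ˣ) n :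
    (PadicAlgCl p)ˣ) : PadicAlgCl p)) (chi_spec p σ ζ)
  simpa only [cyclotome.map_apply, cyclotome.zhatTwist_apply_coe, MulEquiv.coe_toMonoidHom,
    coe_galUnits_apply, Units.val_pow_eq_pow_val] using h

/-! ### The mod-`N` cyclotomic character `χ_N = levelChar N ∘ χ` -/

/-- `ℚ̄_p` has a primitive `n`-th root of unity for every `n ≥ 1`. [cite: NeukirchANT1999, Ch. IV §1] -/
theorem exists_isPrimitiveRoot_padicAlgCl (n : ℕ) (hn : 0 < n) : ∃ ζ : PadicAlgCl p, IsPrimitiveRoot ζ n := by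
  haveI := charZero_padicAlgCl p
  exact cyclotome.exists_isPrimitiveRoot_of_isSepClosed (PadicAlgCl p) n hn

/-- A compatible system of PRIMITIVE roots of unity in `ℚ̄_p` (a generator of `Λ(ℚ̄_pˣ) ≅ Ẑ`).
[cite: MochizukiEtTh2009, §1 p.13] -/
theorem exists_cyclotome_generator :
    ∃ ξ : cyclotome (PadicAlgCl p)ˣ, ∀ n : ℕ+, IsPrimitiveRoot ((ξ : ℕ+ → (PadicAlgCl p)ˣ) n) (n : ℕ) :=
  cyclotome.exists_generator (exists_isPrimitiveRoot_padicAlgCl p)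

/-- **`σ(μ) = μ ^ χ_N(σ)` for EVERY `N`-th root of unity `μ ∈ ℚ̄_p`** (every `μ` is a power of the `N`-th
component of a generator of the cyclotome). [cite: MochizukiEtTh2009, §1 p.13] -/
theorem apply_eq_pow_levelChar_chi (σ : GQp p) (N : ℕ+) {μ : PadicAlgCl p} (hμ : μ ^ (N : ℕ) = 1) :
    σ μ = μ ^ (ZHatLevel.levelChar N (chi p σ)).val := by
  obtain ⟨ξ, hξ⟩ := exists_cyclotome_generator p
  have hprim : IsPrimitiveRoot ((((ξ : ℕ+ → (PadicAlgCl p)ˣ) N) : (PadicAlgCl p)ˣ) : PadicAlgCl p) (N : ℕ) :=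
    (hξ N).map_of_injective Units.coeHom_injective
  obtain ⟨k, -, rfl⟩ := hprim.eq_pow_of_pow_eq_one hμ
  rw [map_pow, apply_cyclotome_eq_pow p σ ξ N, ← pow_mul, ← pow_mul, mul_comm]

/-- **`χ_N(σ)` is read off ONE primitive `N`-th root of unity**: if `σ(ξ) = ξ ^ c` with `ξ` primitive,
then `c ≡ χ_N(σ) (mod N)`. [cite: MochizukiEtTh2009, §1 p.13] -/
theorem levelChar_chi_eq_of_isPrimitiveRoot (σ : GQp p) (N : ℕ+) {ξ : PadicAlgCl p}
    (hξ : IsPrimitiveRoot ξ N) {c : ℕ} (hc : σ ξ = ξ ^ c) :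
    ZHatLevel.levelChar N (chi p σ) = (c : ZMod N) := by
  haveI : NeZero (N : ℕ) := ⟨N.ne_zero⟩
  have h := apply_eq_pow_levelChar_chi p σ N hξ.pow_eq_one
  rw [hc] at h
  -- pass to the unit `u = ξ` to compare exponents modulo `N`
  have hu : IsPrimitiveRoot (hξ.isUnit N.ne_zero).unit (N : ℕ) :=
    IsPrimitiveRoot.coe_units_iff.mp (by rw [IsUnit.unit_spec]; exact hξ)
  have h' : (hξ.isUnit N.ne_zero).unit ^ c = (hξ.isUnit N.ne_zero).unit ^ (ZHatLevel.levelChar N (chi p σ)).val :=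
    Units.ext (by rw [Units.val_pow_eq_pow_val, Units.val_pow_eq_pow_val, IsUnit.unit_spec]; exact h)
  have hmod := (cyclotome.pow_eq_pow_iff_mod_eq hu _ _).mp h'
  rw [← ZMod.natCast_zmod_val (ZHatLevel.levelChar N (chi p σ))]
  exact ((ZMod.natCast_eq_natCast_iff' _ _ _).mpr hmod).symm

/-- **`σ ↦ χ_N(σ)` is LOCALLY CONSTANT on `G_{ℚ_p}`** (Krull topology): `χ_N(σ)` is a function of
`σ(ξ_N)` for a fixed primitive root `ξ_N`, and `σ ↦ σ(ξ_N)` is locally constant (abc-iut-L2-t11's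
`isLocallyConstant_smul_units_of_isAlgebraic`). The continuity input of the χ-twisted semidirect products.
[cite: NeukirchANT1999, Ch. IV §1] -/
theorem isLocallyConstant_levelChar_chi (N : ℕ+) :
    IsLocallyConstant fun σ : GQp p => ZHatLevel.levelChar N (chi p σ) := by
  classical
  haveI : NeZero (N : ℕ) := ⟨N.ne_zero⟩
  obtain ⟨ξ, hξ⟩ := exists_cyclotome_generator p
  set x : (PadicAlgCl p)ˣ := (ξ : ℕ+ → (PadicAlgCl p)ˣ) N with hx
  -- discrete logarithm to the base `x` (any function that is a left inverse of `c ↦ x ^ c.val`)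
  let dlog : (PadicAlgCl p)ˣ → ZMod N := fun y => if h : ∃ c : ZMod N, y = x ^ c.val then h.choose else 0
  have hdlog : ∀ c : ZMod N, dlog (x ^ c.val) = c := by
    intro c
    have hex : ∃ c' : ZMod N, x ^ c.val = x ^ c'.val := ⟨c, rfl⟩
    have hspec := hex.choose_spec
    change (if h : ∃ c' : ZMod N, x ^ c.val = x ^ c'.val then h.choose else 0) = c
    rw [dif_pos hex]
    have hmod := (cyclotome.pow_eq_pow_iff_mod_eq (hξ N) _ _).mp hspec.symm
    rw [Nat.mod_eq_of_lt (ZMod.val_lt _), Nat.mod_eq_of_lt (ZMod.val_lt _)] at hmod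
    exact ZMod.val_injective N hmod
  have hfun : (fun σ : GQp p => ZHatLevel.levelChar N (chi p σ)) = dlog ∘ fun σ : GQp p => σ • x := by
    funext σ
    have hσx : σ • x = x ^ (ZHatLevel.levelChar N (chi p σ)).val := by
      rw [← galUnits_apply_eq_smul]
      exact Units.ext (by
        rw [coe_galUnits_apply, Units.val_pow_eq_pow_val]
        exact apply_cyclotome_eq_pow p σ ξ N)
    simp only [Function.comp_apply, hσx, hdlog]
  rw [hfun]
  exact (isLocallyConstant_smul_units_of_isAlgebraic x).comp dlog

/-- Consequence: the fibres `{σ | χ_N(σ) = c}` are OPEN in `G_{ℚ_p}`. [cite: NeukirchANT1999, Ch. IV §1] -/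
theorem isOpen_setOf_levelChar_chi_eq (N : ℕ+) (c : ZMod N) :
    IsOpen {σ : GQp p | ZHatLevel.levelChar N (chi p σ) = c} :=
  (isLocallyConstant_levelChar_chi p N).isOpen_fiber c

/-- … in particular the kernel of `χ_N` (the `σ` acting trivially on `μ_N`) is an open neighbourhood of `1`.
[cite: NeukirchANT1999, Ch. IV §1] -/
theorem isOpen_setOf_levelChar_chi_eq_one (N : ℕ+) :
    IsOpen {σ : GQp p | ZHatLevel.levelChar N (chi p σ) = 1} :=
  isOpen_setOf_levelChar_chi_eq p N 1

end Literature.AnabelianGeometry.EtaleTheta.SettingModel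

end
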